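import Summits.CriticalPhenomena.SAWScalingLimit.Theses.SAWSchrammPassage

/-!
# Birth skeleton — crux `SideFieldEquicontinuity` (stmt-CriticalPhenomena-17593)

Piece 3/3 of the strategist's typed split of the deciding crux `ClosureToSchramm`
(stmt-CriticalPhenomena-5597, route SAWSchrammPassage; glue `ClosureToSchrammOfPieces`, stmt-17594).
Two registered stubs and the kernel-checked composition `SideFieldEquicontinuity_of`:

* `stub_oneArm` (LOAD-BEARING, open): the interior ONE-ARM bound for the critical SAW, uniformly over
  cell configurations — the `x_c`-weighted walk from `p` to `q` visits the ball `B(x, ρ·dist(x,∂D))`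
  with probability `≤ e` once `x` has `N(e)` cells of room (for SLE(8/3) the decay is `ρ^(2/3)`;
  LawlerSchrammWerner2002OneArm, LawlerSchrammWerner2004SAW §3; nothing uniform is in print for SAW).
* `stub_windStable` (provable now, M): Rouché for the side loop — if the SAW polyline stays at distance
  `> r` from `x`, `x` has two cells of room, `2r ≤ dist(x,∂D)` and `‖x' − x‖ ≤ r`, then the side loop
  `polyline + [δq, pt 1] + arc 1 + [pt 0, δp]` has the same winding number about `x` and `x'`
  (`wind_eq_of_norm_sub_lt`; the two connecting segments have length `δ/2` and end on `∂D`, the arc lies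
  on `∂D`; in the junk case of a non-loop both sides are `0`).
* `SideFieldEquicontinuity_of` (PROVED): `|h_δ(x) − h_δ(x')| ≤ P_δ[one-arm event]` because off that
  event the two winding events coincide (`abs_toReal_sub_le_of_iff_off`), then `stub_oneArm`.
-/

noncomputable section

open MeasureTheory Set
open Literature.Probability.LatticeModels Literature.Probability.RandomPlanarGeometry
open Literature.Topology.PlaneTopology
open Summit.CriticalPhenomena.SAWScalingLimit.Theses.SAWSchrammPassage (SideFieldEquicontinuity)

set_option linter.dupNamespace false

namespace Summit.CriticalPhenomena.SAWScalingLimit.Cruxes.SideFieldEquicontinuity.Birth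

/-! ## Statements -/

/-- The uniform interior ONE-ARM bound for the critical SAW (statement of `stub_oneArm`). [conjecture] -/
def OneArmBound : Prop :=
  ∀ e > (0 : ℝ), ∃ ρ > (0 : ℝ), ∃ N : ℕ, ∀ (δ : ℝ) (S : Finset (Literature.Probability.LatticeModels.Site 2)) (p p' q q' : Literature.Probability.LatticeModels.Site 2) (D : Literature.Probability.RandomPlanarGeometry.DobrushinDomain) (Φ : Literature.Probability.RandomPlanarGeometry.ConformalEquiv UpperHalfPlane.upperHalfPlaneSet D.carrier) (x : ℂ), 0 < δ → p ∈ S → q ∈ S → p' ∉ S → q' ∉ S → (Literature.Probability.LatticeModels.zdGraph 2).Adj p p' → (Literature.Probability.LatticeModels.zdGraph 2).Adj q q' → D.carrier = interior ({w : ℂ | ∃ v ∈ S, |w.re - (Literature.Probability.LatticeModels.meshPoint δ v).re| ≤ δ / 2 ∧ |w.im - (Literature.Probability.LatticeModels.meshPoint δ v).im| ≤ δ / 2 ∧ |w.re - (Literature.Probability.LatticeModels.meshPoint δ v).re| + |w.im - (Literature.Probability.LatticeModels.meshPoint δ v).im| ≤ 9 * δ / 10} ∪ {w : ℂ | ∃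 v ∈ S, v + ![1, 0] ∈ S ∧ v + ![0, 1] ∈ S ∧ v + ![1, 1] ∈ S ∧ |w.re - (Literature.Probability.LatticeModels.meshPoint δ v).re - δ / 2| + |w.im - (Literature.Probability.LatticeModels.meshPoint δ v).im - δ / 2| ≤ δ / 10}) → D.pt 0 = (Literature.Probability.LatticeModels.meshPoint δ p + Literature.Probability.LatticeModels.meshPoint δ p') / 2 → D.pt 1 = (Literature.Probability.LatticeModels.meshPoint δ q + Literature.Probability.LatticeModels.meshPoint δ q') / 2 → D.IsChordalUniformizing Φ → x ∈ D.carrier → (N : ℝ) * δ ≤ Metric.infDist x D.carrierᶜ → (Literature.Probability.RandomPlanarGeometry.SAW.law D.carrier δ p q {γ | ∃ t : unitInterval, dist ((γ.walk.toCurve (Literature.Probability.LatticeModels.meshPoint δ)) t) x ≤ ρ * Metric.infDist x D.carrierᶜ}).toReal ≤ e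

/-- Winding stability of the side loop under a small move of the base point (statement of `stub_windStable`). [folklore] -/
def WindStable : Prop :=
  ∀ (δ : ℝ) (p p' q q' : Literature.Probability.LatticeModels.Site 2) (D : Literature.Probability.RandomPlanarGeometry.DobrushinDomain) (γ : Literature.Probability.RandomPlanarGeometry.SAW.DomainSAW D.carrier δ p q) (x x' : ℂ) (r : ℝ), let L : Literature.Probability.RandomPlanarGeometry.SAW.DomainSAW D.carrier δ p q → ℝ → ℂ := fun γ t => if t ≤ 1 / 2 then (γ.walk.toCurve (Literature.Probability.LatticeModels.meshPoint δ)) (Set.projIcc (0 : ℝ) 1 zero_le_one (2 * t)) else if 2 * t - 1 ≤ 1 / 3 then Literature.Probability.LatticeModels.meshPoint δ q + ((3 * (2 * t - 1) : ℝ) : ℂ) * (D.pt 1 - Literature.Probability.LatticeModels.meshPoint δ q) else if 2 * t - 1 ≤ 2 / 3 then D.boundary (D.mark 1 + (3 * (2 * t - 1) - 1) * (D.mark 0 + 1 - D.mark 1)) else D.pt 0 + ((3 * (2 * t - 1) - 2 : ℝ) : ℂ) * (Literature.Probability.LatticeModels.meshPoint δ p - D.pt 0); 0 < δ → (Literature.Probability.LatticeModels.zdGraph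 2).Adj p p' → (Literature.Probability.LatticeModels.zdGraph 2).Adj q q' → D.pt 0 = (Literature.Probability.LatticeModels.meshPoint δ p + Literature.Probability.LatticeModels.meshPoint δ p') / 2 → D.pt 1 = (Literature.Probability.LatticeModels.meshPoint δ q + Literature.Probability.LatticeModels.meshPoint δ q') / 2 → x ∈ D.carrier → 2 * δ ≤ Metric.infDist x D.carrierᶜ → 2 * r ≤ Metric.infDist x D.carrierᶜ → ‖x' - x‖ ≤ r → (∀ t : unitInterval, r < dist ((γ.walk.toCurve (Literature.Probability.LatticeModels.meshPoint δ)) t) x) → Literature.Topology.PlaneTopology.wind (fun t => L γ t - x') = Literature.Topology.PlaneTopology.wind (fun t => L γ t - x)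

/-! ## Stubs (the only `sorry`s) -/

/-- **Stub (load-bearing): the uniform interior one-arm bound for the critical SAW.** [conjecture] -/
theorem stub_oneArm : OneArmBound := by
  sorry

/-- **Stub: winding stability of the side loop under a small move of the base point** (Rouché). [folklore] -/
theorem stub_windStable : WindStable := by
  sorry

namespace __Registered

/-- Alias of `OneArmBound` keyed by the registered stub name. -/
abbrev stub_oneArm : Prop := OneArmBound
/-- Alias of `WindStable` keyed by the registered stub name. -/
abbrev stub_windStable : Prop := WindStable

end __Registered

/-- The critical SAW law gives mass at most one to every event (also in the junk cases). [folklore] -/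
theorem law_apply_le_one {Ω : Set ℂ} {δ : ℝ} {a b : Site 2} (A : Set (SAW.DomainSAW Ω δ a b)) :
    SAW.law Ω δ a b A ≤ 1 := by
  rw [SAW.law, Measure.smul_apply, smul_eq_mul]
  have hA : SAW.weight Ω δ a b A ≤ SAW.weight Ω δ a b univ := measure_mono (subset_univ _)
  rcases eq_or_ne (SAW.weight Ω δ a b univ) 0 with h0 | h0
  · rw [h0] at hA
    rw [le_antisymm hA bot_le, mul_zero]
    exact zero_le_one
  rcases eq_or_ne (SAW.weight Ω δ a b univ) ⊤ with ht | ht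
  · rw [ht, ENNReal.inv_top, zero_mul]
    exact zero_le_one
  calc (SAW.weight Ω δ a b univ)⁻¹ * SAW.weight Ω δ a b A
      ≤ (SAW.weight Ω δ a b univ)⁻¹ * SAW.weight Ω δ a b univ := by gcongr
    _ = 1 := ENNReal.inv_mul_cancel h0 ht

/-- Two events that coincide off a third differ in (sub-probability) mass by at most the mass of the
third. [folklore] -/
theorem abs_toReal_sub_le_of_iff_off {α : Type*} [MeasurableSpace α] (μ : Measure α)
    (hμ : ∀ s, μ s ≤ 1) (A A' B : Set α) (h : ∀ ω, ω ∉ B → (ω ∈ A ↔ ω ∈ A')) :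
    |(μ A).toReal - (μ A').toReal| ≤ (μ B).toReal := by
  have htop : ∀ s, μ s ≠ ⊤ := fun s => ne_top_of_le_ne_top ENNReal.one_ne_top (hμ s)
  have h1 : μ A ≤ μ A' + μ B :=
    calc μ A ≤ μ (A' ∪ B) := measure_mono fun ω hω => by
            by_cases hb : ω ∈ B
            · exact Or.inr hb
            · exact Or.inl ((h ω hb).1 hω)
      _ ≤ μ A' + μ B := measure_union_le _ _
  have h2 : μ A' ≤ μ A + μ B :=
    calc μ A' ≤ μ (A ∪ B) := measure_mono fun ω hω => by
            by_cases hb : ω ∈ B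
            · exact Or.inr hb
            · exact Or.inl ((h ω hb).2 hω)
      _ ≤ μ A + μ B := measure_union_le _ _
  have h1' : (μ A).toReal ≤ (μ A').toReal + (μ B).toReal := by
    have := ENNReal.toReal_mono (ENNReal.add_ne_top.2 ⟨htop A', htop B⟩) h1
    rwa [ENNReal.toReal_add (htop A') (htop B)] at this
  have h2' : (μ A').toReal ≤ (μ A).toReal + (μ B).toReal := by
    have := ENNReal.toReal_mono (ENNReal.add_ne_top.2 ⟨htop A, htop B⟩) h2
    rwa [ENNReal.toReal_add (htop A) (htop B)] at this
  rw [abs_sub_le_iff]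
  constructor <;> linarith

/-- **Composition (kernel-checked): one-arm bound + winding stability ⇒ `SideFieldEquicontinuity`.** [folklore] -/
theorem SideFieldEquicontinuity_of :
    __Registered.stub_oneArm → __Registered.stub_windStable →
      Summit.CriticalPhenomena.SAWScalingLimit.Theses.SAWSchrammPassage.SideFieldEquicontinuity := by
  intro hArm hW e he
  obtain ⟨ρ₁, hρ₁, N₁, hArm'⟩ := hArm e he
  refine ⟨min ρ₁ (1 / 2), lt_min hρ₁ one_half_pos, max N₁ 2, ?_⟩
  intro δ S p p' q q' D Φ x x' L hδ hp hq hp' hq' hpp' hqq' hcar hpt0 hpt1 hΦ hx hroom hxx'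
  set d : ℝ := Metric.infDist x D.carrierᶜ with hd
  have hN₁ : (N₁ : ℝ) * δ ≤ d :=
    le_trans (mul_le_mul_of_nonneg_right (by exact_mod_cast le_max_left N₁ 2) hδ.le) hroom
  have h2δ : 2 * δ ≤ d :=
    le_trans (mul_le_mul_of_nonneg_right (by exact_mod_cast le_max_right N₁ 2) hδ.le) hroom
  have hd0 : 0 ≤ d := Metric.infDist_nonneg
  have hρd : min ρ₁ (1 / 2) * d ≤ ρ₁ * d := mul_le_mul_of_nonneg_right (min_le_left _ _) hd0
  have h2r : 2 * (min ρ₁ (1 / 2) * d) ≤ d := by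
    have : min ρ₁ (1 / 2) ≤ 1 / 2 := min_le_right _ _
    nlinarith
  -- the one-arm event
  have hB := hArm' δ S p p' q q' D Φ x hδ hp hq hp' hq' hpp' hqq' hcar hpt0 hpt1 hΦ hx hN₁
  -- off the one-arm event the two winding events coincide
  have hiff : ∀ γ : SAW.DomainSAW D.carrier δ p q,
      γ ∉ {γ | ∃ t : unitInterval, dist ((γ.walk.toCurve (meshPoint δ)) t) x ≤ ρ₁ * d} →
      (γ ∈ {γ | wind (fun t => L γ t - x) ≠ 0} ↔ γ ∈ {γ | wind (fun t => L γ t - x') ≠ 0}) := by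
    intro γ hγ
    have hfar : ∀ t : unitInterval, min ρ₁ (1 / 2) * d < dist ((γ.walk.toCurve (meshPoint δ)) t) x :=
      fun t => lt_of_le_of_lt hρd (lt_of_not_ge fun hle => hγ ⟨t, hle⟩)
    have key : wind (fun t => L γ t - x') = wind (fun t => L γ t - x) :=
      hW δ p p' q q' D γ x x' (min ρ₁ (1 / 2) * d) hδ hpp' hqq' hpt0 hpt1 hx h2δ h2r hxx' hfar
    simp only [Set.mem_setOf_eq]
    rw [key]
  exact (abs_toReal_sub_le_of_iff_off (SAW.law D.carrier δ p q) law_apply_le_one _ _ _ hiff).trans hB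

/-- WIRING CHECK (an `example`: no pre-composed witness enters the environment). -/
example : Summit.CriticalPhenomena.SAWScalingLimit.Theses.SAWSchrammPassage.SideFieldEquicontinuity :=
  SideFieldEquicontinuity_of stub_oneArm stub_windStable

end Summit.CriticalPhenomena.SAWScalingLimit.Cruxes.SideFieldEquicontinuity.Birth

end
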